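import Literature.Topology.FourManifolds.PlumbingGlue
import Literature.Topology.FourManifolds.PlumbingCorner
import Literature.Topology.FourManifolds.HomotopySpheresBP
import HarnessLib

/-!
# The size function of the `E₈` plumbing and the compact plumbing `M(4m)` as a regular sublevel set

Topic `Literature/Topology/FourManifolds`; third file of the construction of Kosinski's `M(4m)`
(A. Kosinski, *Differential Manifolds* (1993), VI.12, pp. 119–122), fact seat of
`Literature.Topology.FourManifolds.HomotopySphere.exists_intersectionForm_equivalent_e8Form`,
after `PlumbingGlue.lean` (the open plumbing `PV` of eight tubes of the diagonal of `Sᵏ × Sᵏ`).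

Kosinski's `M(4n)` is a COMPACT manifold with boundary: eight closed disc bundles plumbed, with
the corners `∂D × ∂D` of the plumbing squares straightened (VI.12 p. 120 with VI.6). Here it is
cut out of the open plumbing `PV` as the **regular sublevel set `{ρ ≤ ε}` of a smooth size
function** `ρ : PV → ℝ` (the tree's `RegularSublevel`, Milnor, *Morse theory* (1963), Thm. 3.1):
on each tube `ρ` is the squared fibre radius `b = 1 - ⟪p, q⟫²`, except over the plumbing domains
`D_j`, where it is the corner function `G(a_j, b)` of `PlumbingCorner.lean` in the squared base
radius `a_j = 1 - ⟪p, e_j⟫²` and `b` — a symmetric rounding of `min(a_j, b)`, so that it is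
compatible with the plumbing involution (which exchanges `a_j` and `b`) and descends to `PV`.

* `Plumbing.aFn e`, `Plumbing.bFn` — `a = 1 - ⟪p, e⟫²`, `b = 1 - ⟪p, q⟫²` on `Sᵏ × Sᵏ`;
* `Plumbing.termFn`, `Plumbing.rhoHat v` — the correction term `𝟙_{D_j} (G(a_j, b) - b)` and the
  size function of the `v`-th tube `ρ̂ᵥ = b + Σ_{w ~ v} term_{e(v,w)}` on `Sᵏ × Sᵏ`; smooth on the
  tube (`contMDiffAt_rhoHat`: the term vanishes identically near `∂D_j`, the corner function being
  `min(a_j, b) = b` there); `rhoHat_pm` — compatibility with the plumbing maps;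
* **`Plumbing.rho`** — the size function on `PV` (`rho_ι : ρ (ι v x) = ρ̂ᵥ x`), smooth
  (`contMDiff_rho`).

Regularity of the positive levels, compactness of the sublevel sets and the compact plumbing
follow in the sequel. Everything is proved; no named facts (D-0026).

## References

* A. Kosinski, *Differential Manifolds*, Academic Press 1993, VI.6, VI.11–12 (pp. 115–122).
  [Kosinski1993]
* J. Milnor, *Morse theory*, Ann. of Math. Studies 51 (1963), §3 Thm. 3.1. [Milnor1963]
-/

open scoped Manifold ContDiff Topology RealInnerProductSpace
open Set Function Module Filter

noncomputable section

namespace Literature.Topology.FourManifolds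

namespace Plumbing

/-- Local notation: `𝔼 n` is the model Euclidean space `EuclideanSpace ℝ (Fin n)`. -/
local notation "𝔼 " n:arg => EuclideanSpace ℝ (Fin n)

/-- Local notation: `𝕊 n` is the unit sphere in `EuclideanSpace ℝ (Fin (n + 1))`. -/
local notation "𝕊 " n:arg => (Metric.sphere (0 : EuclideanSpace ℝ (Fin (n + 1))) 1)

variable {k : ℕ} {c : ℝ}

/-! ### §1 The squared radii and the correction terms on `Sᵏ × Sᵏ` -/

/-- **The squared base radius** `a = 1 - ⟪p, e⟫²` relative to the pole `e` (the squared norm of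
the projection of `p` to `e^⊥`). [folklore] -/
def aFn (e : 𝕊 k) (pq : (𝕊 k) × (𝕊 k)) : ℝ := 1 - baseHt e pq ^ 2

/-- **The squared fibre radius** `b = 1 - ⟪p, q⟫²`. [folklore] -/
def bFn (pq : (𝕊 k) × (𝕊 k)) : ℝ := 1 - fibHt pq ^ 2

/-- `aFn_apply` (aFn apply). [folklore] -/
theorem aFn_apply (e : 𝕊 k) (pq : (𝕊 k) × (𝕊 k)) : aFn e pq = 1 - baseHt e pq ^ 2 := rfl

/-- `bFn_apply` (bFn apply). [folklore] -/
theorem bFn_apply (pq : (𝕊 k) × (𝕊 k)) : bFn pq = 1 - fibHt pq ^ 2 := rfl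

/-- `contMDiff_aFn` (contMDiff aFn). [folklore] -/
theorem contMDiff_aFn (e : 𝕊 k) : ContMDiff ((𝓡 k).prod (𝓡 k)) 𝓘(ℝ, ℝ) ∞ (aFn e) :=
  contMDiff_const.sub ((contMDiff_baseHt e).pow 2)

/-- `contMDiff_bFn` (contMDiff bFn). [folklore] -/
theorem contMDiff_bFn : ContMDiff ((𝓡 k).prod (𝓡 k)) 𝓘(ℝ, ℝ) ∞ (bFn (k := k)) :=
  contMDiff_const.sub (contMDiff_fibHt.pow 2)

/-- `continuous_aFn` (continuous aFn). [folklore] -/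
theorem continuous_aFn (e : 𝕊 k) : Continuous (aFn e) := (contMDiff_aFn e).continuous

/-- `continuous_bFn` (continuous bFn). [folklore] -/
theorem continuous_bFn : Continuous (bFn (k := k)) := contMDiff_bFn.continuous

/-- `aFn_nonneg` (aFn nonneg). [folklore] -/
theorem aFn_nonneg (e : 𝕊 k) (pq : (𝕊 k) × (𝕊 k)) : 0 ≤ aFn e pq := by
  have := abs_baseHt_le_one e pq
  rw [aFn, sub_nonneg, sq_le_one_iff_abs_le_one]; exact this

/-- `bFn_nonneg` (bFn nonneg). [folklore] -/
theorem bFn_nonneg (pq : (𝕊 k) × (𝕊 k)) : 0 ≤ bFn pq := by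
  have := abs_fibHt_le_one pq
  rw [bFn, sub_nonneg, sq_le_one_iff_abs_le_one]; exact this

/-- `aFn_le_one` (aFn le one). [folklore] -/
theorem aFn_le_one (e : 𝕊 k) (pq : (𝕊 k) × (𝕊 k)) : aFn e pq ≤ 1 := by
  rw [aFn]; nlinarith [sq_nonneg (baseHt e pq)]

/-- `bFn_le_one` (bFn le one). [folklore] -/
theorem bFn_le_one (pq : (𝕊 k) × (𝕊 k)) : bFn pq ≤ 1 := by
  rw [bFn]; nlinarith [sq_nonneg (fibHt pq)]

/-- The squared radius of the tube and of the caps: `r² = 1 - c²`. [folklore] -/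
def rsq (c : ℝ) : ℝ := 1 - c ^ 2

/-- `rsq_apply` (rsq apply). [folklore] -/
theorem rsq_apply (c : ℝ) : rsq c = 1 - c ^ 2 := rfl

/-- `rsq_pos` (rsq pos). [folklore] -/
theorem rsq_pos (hc : IsParam c) : 0 < rsq c := by
  have := hc.lt_one; have := hc.nonneg; rw [rsq]; nlinarith

/-- On the cap `{⟪p, e⟫ > c}` (`c ≥ 0`): `a < r² = 1 - c²`. [folklore] -/
theorem aFn_lt (e : 𝕊 k) {pq : (𝕊 k) × (𝕊 k)} (hc : 0 ≤ c) (h : c < baseHt e pq) : aFn e pq < rsq c := by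
  rw [aFn, rsq]; nlinarith

/-- On the tube `{⟪p, q⟫ > c}` (`c ≥ 0`): `b < r² = 1 - c²`. [folklore] -/
theorem bFn_lt {pq : (𝕊 k) × (𝕊 k)} (hc : 0 ≤ c) (h : c < fibHt pq) : bFn pq < rsq c := by
  rw [bFn, rsq]; nlinarith

/-- At the edge of the cap (`⟪p, e⟫ = c`): `a = r²`. [folklore] -/
theorem aFn_eq_rsq (e : 𝕊 k) {pq : (𝕊 k) × (𝕊 k)} (h : baseHt e pq = c) : aFn e pq = rsq c := by
  rw [aFn, h, rsq]

/-- `a` and `b` are exchanged by the plumbing map (on `D_e(-1)`). [cite: Kosinski1993, VI.12 p. 120] -/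
theorem aFn_plumbMap (e : 𝕊 k) {pq : (𝕊 k) × (𝕊 k)} (h : -1 < baseHt e pq) :
    aFn e (plumbMap e pq) = bFn pq := by
  rw [aFn, baseHt_plumbMap e h, bFn]

/-- `bFn_plumbMap` (bFn plumbMap). [folklore] -/
theorem bFn_plumbMap (e : 𝕊 k) {pq : (𝕊 k) × (𝕊 k)} (h : -1 < baseHt e pq) (h' : -1 < fibHt pq) :
    bFn (plumbMap e pq) = aFn e pq := by
  rw [bFn, fibHt_plumbMap e h h', aFn]

/-- The band slope used to round the corners: `s = 1/4`. [folklore] -/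
def bandSlope : ℝ := 1 / 4

/-- `bandSlope_pos` (bandSlope pos). [folklore] -/
theorem bandSlope_pos : 0 < bandSlope := by norm_num [bandSlope]

/-- `bandSlope_lt_one` (bandSlope lt one). [folklore] -/
theorem bandSlope_lt_one : bandSlope < 1 := by norm_num [bandSlope]

open Classical in
variable (k) in
/-- **The correction term of colour `j`**: `𝟙_{D_j} · (G(a_j, b) - b)` — replaces the squared fibre
radius `b` by the corner function over the plumbing domain `D_j`. [cite: Kosinski1993, VI.12 p. 120] -/
def termFn (c : ℝ) (j : Fin 3) (pq : (𝕊 k) × (𝕊 k)) : ℝ :=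
  if pq ∈ dom k c j then cornerFn (rsq c) bandSlope (aFn (pole k j.val) pq, bFn pq) - bFn pq else 0

/-- `termFn_of_mem` (termFn of mem). [folklore] -/
theorem termFn_of_mem {j : Fin 3} {pq : (𝕊 k) × (𝕊 k)} (h : pq ∈ dom k c j) :
    termFn k c j pq = cornerFn (rsq c) bandSlope (aFn (pole k j.val) pq, bFn pq) - bFn pq := by
  rw [termFn, if_pos h]

/-- `termFn_of_not_mem` (termFn of not mem). [folklore] -/
theorem termFn_of_not_mem {j : Fin 3} {pq : (𝕊 k) × (𝕊 k)} (h : pq ∉ dom k c j) : termFn k c j pq = 0 := by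
  rw [termFn, if_neg h]

/-- On `D_j` the pair `(a_j, b)` lies in the half plane `{a + b < 2r²}` where the corner function
is smooth. [folklore] -/
theorem aFn_add_bFn_lt (hc : IsParam c) {j : Fin 3} {pq : (𝕊 k) × (𝕊 k)} (h : pq ∈ dom k c j) :
    aFn (pole k j.val) pq + bFn pq < 2 * rsq c := by
  have h1 := aFn_lt (pole k j.val) hc.nonneg h.1
  have h2 := bFn_lt hc.nonneg h.2
  linarith

/-- The correction term is `≤ 0` (`G ≤ min(a, b) ≤ b`). [folklore] -/
theorem termFn_nonpos (hc : IsParam c) (j : Fin 3) (pq : (𝕊 k) × (𝕊 k)) : termFn k c j pq ≤ 0 := by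
  by_cases h : pq ∈ dom k c j
  · rw [termFn_of_mem h, sub_nonpos]
    exact (cornerFn_le_min bandSlope_pos (aFn_add_bFn_lt hc h)).trans (min_le_right _ _)
  · rw [termFn_of_not_mem h]

/-- **The correction term vanishes near the edge of the plumbing domain**: on the open set
`V_j = {⟪p, e_j⟫ < c} ∪ {(1 + s) a_j > (1 - s) b + 2 s r²}` (which contains every point of the
tube with `⟪p, e_j⟫ ≤ c`), `term_j = 0` — inside `D_j` the wedge condition holds, so
`G(a_j, b) = min(a_j, b) = b`. [folklore] -/
def vanishSet (k : ℕ) (c : ℝ) (j : Fin 3) : Set ((𝕊 k) × (𝕊 k)) :=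
  {pq | baseHt (pole k j.val) pq < c} ∪
    {pq | (1 - bandSlope) * bFn pq + 2 * bandSlope * rsq c < (1 + bandSlope) * aFn (pole k j.val) pq}

/-- `isOpen_vanishSet` (isOpen vanishSet). [folklore] -/
theorem isOpen_vanishSet (j : Fin 3) : IsOpen (vanishSet k c j) := by
  apply IsOpen.union
  · exact isOpen_lt (continuous_baseHt _) continuous_const
  · exact isOpen_lt ((continuous_const.mul continuous_bFn).add continuous_const)
      (continuous_const.mul (continuous_aFn _))

/-- A tube point off `D_j` (i.e. with `⟪p, e_j⟫ ≤ c`) lies in `V_j`. [folklore] -/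
theorem mem_vanishSet_of_not_mem (hc : IsParam c) {j : Fin 3} {pq : (𝕊 k) × (𝕊 k)}
    (htube : c < fibHt pq) (h : pq ∉ dom k c j) : pq ∈ vanishSet k c j := by
  have hb : baseHt (pole k j.val) pq ≤ c := by
    by_contra hlt; exact h ⟨lt_of_not_ge hlt, htube⟩
  rcases hb.lt_or_eq with hlt | heq
  · exact Or.inl hlt
  · right
    have ha : aFn (pole k j.val) pq = rsq c := aFn_eq_rsq _ heq
    have hb' := bFn_lt hc.nonneg htube
    change (1 - bandSlope) * bFn pq + 2 * bandSlope * rsq c < (1 + bandSlope) * aFn (pole k j.val) pq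
    rw [ha]
    have hs := bandSlope_lt_one
    have hs0 := bandSlope_pos
    nlinarith

/-- On `V_j` the correction term vanishes. [folklore] -/
theorem termFn_eq_zero_of_mem_vanishSet (hc : IsParam c) {j : Fin 3} {pq : (𝕊 k) × (𝕊 k)}
    (h : pq ∈ vanishSet k c j) : termFn k c j pq = 0 := by
  by_cases hd : pq ∈ dom k c j
  · rcases h with h1 | h2
    · exact absurd hd.1 (not_lt.2 h1.le)
    · rw [termFn_of_mem hd]
      simp only [mem_setOf_eq] at h2
      have hlt := aFn_add_bFn_lt hc hd
      have hb := bFn_lt hc.nonneg hd.2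
      have hs0 := bandSlope_pos
      have hab : bFn pq < aFn (pole k j.val) pq := by nlinarith
      -- the wedge condition: `σ ≤ a - b`
      have hwedge : bandW (rsq c) bandSlope (aFn (pole k j.val) pq, bFn pq) ≤
          |aFn (pole k j.val) pq - bFn pq| := by
        rw [abs_of_pos (sub_pos.2 hab), bandW]
        simp only
        nlinarith
      rw [cornerFn_eq_min bandSlope_pos hlt hwedge]
      simp only
      rw [min_eq_right hab.le, sub_self]
  · exact termFn_of_not_mem hd

/-- **The correction term is smooth on the tube.** [folklore] -/
theorem contMDiffAt_termFn (hc : IsParam c) (j : Fin 3) {pq : (𝕊 k) × (𝕊 k)} (htube : c < fibHt pq) :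
    ContMDiffAt ((𝓡 k).prod (𝓡 k)) 𝓘(ℝ, ℝ) ∞ (termFn k c j) pq := by
  by_cases hd : pq ∈ dom k c j
  · -- inside `D_j`: the smooth formula
    have hG : ContMDiffAt ((𝓡 k).prod (𝓡 k)) 𝓘(ℝ, ℝ) ∞
        (fun x => cornerFn (rsq c) bandSlope (aFn (pole k j.val) x, bFn x) - bFn x) pq := by
      refine ContMDiffAt.sub ?_ contMDiff_bFn.contMDiffAt
      have hpair : ContMDiffAt ((𝓡 k).prod (𝓡 k)) 𝓘(ℝ, ℝ × ℝ) ∞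
          (fun x => (aFn (pole k j.val) x, bFn x)) pq :=
        ((contMDiff_aFn _).prodMk_space contMDiff_bFn).contMDiffAt
      exact (contDiffAt_cornerFn bandSlope_pos (aFn_add_bFn_lt hc hd)).comp_contMDiffAt hpair
    refine hG.congr_of_eventuallyEq ?_
    filter_upwards [(isOpen_dom c j).mem_nhds hd] with x hx
    exact termFn_of_mem hx
  · -- off `D_j`: locally zero
    have h0 : ContMDiffAt ((𝓡 k).prod (𝓡 k)) 𝓘(ℝ, ℝ) ∞ (fun _ : (𝕊 k) × (𝕊 k) => (0 : ℝ)) pq :=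
      contMDiffAt_const
    refine h0.congr_of_eventuallyEq ?_
    filter_upwards [(isOpen_vanishSet j).mem_nhds (mem_vanishSet_of_not_mem hc htube hd)] with x hx
    exact termFn_eq_zero_of_mem_vanishSet hc hx

/-- The correction term is compatible with the plumbing involution: `term_j ∘ plumbMap e_j = G(a_j, b) - a_j`
on `D_j`, i.e. `b + term_j` is invariant. [cite: Kosinski1993, VI.12 p. 120] -/
theorem bFn_add_termFn_plumbMap (hc : IsParam c) {j : Fin 3} {pq : (𝕊 k) × (𝕊 k)} (h : pq ∈ dom k c j) :
    bFn (plumbMap (pole k j.val) pq) + termFn k c j (plumbMap (pole k j.val) pq) = bFn pq + termFn k c j pq := by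
  have h' : plumbMap (pole k j.val) pq ∈ dom k c j := mapsTo_plumbMap_dom hc j h
  have hb : -1 < baseHt (pole k j.val) pq := lt_of_le_of_lt hc.neg_one_le h.1
  have hf : -1 < fibHt pq := lt_of_le_of_lt hc.neg_one_le h.2
  rw [termFn_of_mem h', termFn_of_mem h, aFn_plumbMap _ hb, bFn_plumbMap _ hb hf, cornerFn_comm]
  ring

/-! ### §2 The size function of a tube and of the plumbing -/

variable (k c) in
/-- **The size function of the `v`-th tube** on `Sᵏ × Sᵏ`:
`ρ̂ᵥ = b + Σ_{w : Γ₈(v,w) = 1} term_{e(v, w)}` — the squared fibre radius, corrected over the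
plumbing domains of the edges at `v`. [cite: Kosinski1993, VI.12 pp. 120–122] -/
def rhoHat (v : Fin 8) (pq : (𝕊 k) × (𝕊 k)) : ℝ :=
  bFn pq + ∑ w ∈ Finset.univ.filter (fun w => kosinskiGamma8 v w = 1), termFn k c (ecol v w) pq

/-- `rhoHat_le_bFn` (rhoHat le bFn). [folklore] -/
theorem rhoHat_le_bFn (hc : IsParam c) (v : Fin 8) (pq : (𝕊 k) × (𝕊 k)) : rhoHat k c v pq ≤ bFn pq := by
  rw [rhoHat, add_le_iff_nonpos_right]
  exact Finset.sum_nonpos fun w _ => termFn_nonpos hc _ pq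

/-- **The size function is smooth on the tube.** [folklore] -/
theorem contMDiffAt_rhoHat (hc : IsParam c) (v : Fin 8) {pq : (𝕊 k) × (𝕊 k)} (htube : c < fibHt pq) :
    ContMDiffAt ((𝓡 k).prod (𝓡 k)) 𝓘(ℝ, ℝ) ∞ (rhoHat k c v) pq := by
  unfold rhoHat
  refine contMDiff_bFn.contMDiffAt.add ?_
  exact ContMDiffAt.sum fun w _ => contMDiffAt_termFn hc (ecol v w) htube

/-- The size function of the `v`-th tube on the tube `N`. [folklore] -/
def rhoTb (v : Fin 8) (x : Tb k c) : ℝ := rhoHat k c v x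

/-- `rhoTb_apply` (rhoTb apply). [folklore] -/
theorem rhoTb_apply (v : Fin 8) (x : Tb k c) : rhoTb v x = rhoHat k c v x := rfl

/-- `contMDiff_rhoTb` (contMDiff rhoTb). [folklore] -/
theorem contMDiff_rhoTb (hc : IsParam c) (v : Fin 8) :
    ContMDiff ((𝓡 k).prod (𝓡 k)) 𝓘(ℝ, ℝ) ∞ (rhoTb (k := k) (c := c) v) := fun x =>
  (contMDiffAt_rhoHat hc v x.2).comp x contMDiff_subtype_val.contMDiffAt

/-- `Γ₈` is symmetric. [cite: Kosinski1993, VI.12 p. 122 (the matrix Γ₈)] -/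
theorem gamma8_comm : ∀ v w : Fin 8, kosinskiGamma8 v w = kosinskiGamma8 w v := by decide

/-- At a vertex, the edges of different neighbours have different colours. [folklore] -/
theorem ecol_injective_of_edge {v w w' : Fin 8} (hw : kosinskiGamma8 v w = 1) (hw' : kosinskiGamma8 v w' = 1)
    (h : ecol v w = ecol v w') : w = w' := by
  revert v w w'
  decide

/-- On the plumbing domain of the edge `{v, w}` the size function is the corner function
`G(a_j, b)`, `j = e(v, w)` (all other correction terms vanish there, the domains being disjoint).
[cite: Kosinski1993, VI.12 pp. 120–122] -/
theorem rhoHat_eq_of_mem (hk : 2 ≤ k) (hc : IsParam c) {v w : Fin 8} (hvw : kosinskiGamma8 v w = 1)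
    {pq : (𝕊 k) × (𝕊 k)} (h : pq ∈ dom k c (ecol v w)) :
    rhoHat k c v pq = bFn pq + termFn k c (ecol v w) pq := by
  rw [rhoHat, add_right_inj]
  rw [Finset.sum_eq_single_of_mem w (by simp [hvw])]
  intro w' hw' hne
  have hw'1 : kosinskiGamma8 v w' = 1 := by simpa using hw'
  apply termFn_of_not_mem
  intro h'
  have hcol : ecol v w' ≠ ecol v w := fun heq => hne (ecol_injective_of_edge hw'1 hvw heq)
  exact dom_disjoint hk hc hcol h' h

/-- `rhoHat_eq_cornerFn` (rhoHat eq cornerFn). [folklore] -/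
theorem rhoHat_eq_cornerFn (hk : 2 ≤ k) (hc : IsParam c) {v w : Fin 8} (hvw : kosinskiGamma8 v w = 1)
    {pq : (𝕊 k) × (𝕊 k)} (h : pq ∈ dom k c (ecol v w)) :
    rhoHat k c v pq = cornerFn (rsq c) bandSlope (aFn (pole k (ecol v w).val) pq, bFn pq) := by
  rw [rhoHat_eq_of_mem hk hc hvw h, termFn_of_mem h]; ring

/-- Off all plumbing domains of the edges at `v`, the size function is the squared fibre radius.
[folklore] -/
theorem rhoHat_eq_bFn (v : Fin 8) {pq : (𝕊 k) × (𝕊 k)}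
    (h : ∀ w, kosinskiGamma8 v w = 1 → pq ∉ dom k c (ecol v w)) : rhoHat k c v pq = bFn pq := by
  rw [rhoHat, add_eq_left]
  refine Finset.sum_eq_zero fun w hw => termFn_of_not_mem (h w (by simpa using hw))

/-- **Compatibility of the size functions with the plumbing maps**: `ρ̂ᵥ x = ρ̂_w (plumbMap x)`
for an edge `{v, w}` and `x` in its plumbing domain. [cite: Kosinski1993, VI.12 pp. 120–122] -/
theorem rhoHat_plumbMap (hk : 2 ≤ k) (hc : IsParam c) {v w : Fin 8} (hvw : kosinskiGamma8 v w = 1)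
    {pq : (𝕊 k) × (𝕊 k)} (h : pq ∈ dom k c (ecol v w)) :
    rhoHat k c w (plumbMap (pole k (ecol v w).val) pq) = rhoHat k c v pq := by
  have hwv : kosinskiGamma8 w v = 1 := by rw [gamma8_comm]; exact hvw
  have h' : plumbMap (pole k (ecol v w).val) pq ∈ dom k c (ecol w v) := by
    rw [ecol_comm]; exact mapsTo_plumbMap_dom hc _ h
  rw [rhoHat_eq_of_mem hk hc hwv h', rhoHat_eq_of_mem hk hc hvw h, ecol_comm w v]
  exact bFn_add_termFn_plumbMap hc h

variable {n : ℕ} (hk : 2 ≤ k) (hc : IsParam c) (hkn : k + k = n + 1)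

/-- **The size function `ρ` of the `E₈` plumbing** (descended from the `ρ̂ᵥ`). Its sublevel set
`{ρ ≤ ε}` is Kosinski's compact plumbing `M(4m)` with straightened corners.
[cite: Kosinski1993, VI.12 pp. 120–122] -/
def rho : PV k c hk hc hkn → ℝ :=
  desc hk hc hkn (fun v x => rhoTb v x) fun v w x hvw hx => by
    rw [rhoTb_apply, rhoTb_apply, coe_pm_of_mem hc hx, rhoHat_plumbMap hk hc hvw hx]

/-- `ρ` on the `v`-th tube is `ρ̂ᵥ`. [folklore] -/
@[simp] theorem rho_ι (v : Fin 8) (x : Tb k c) : rho hk hc hkn (ι hk hc hkn v x) = rhoHat k c v x :=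
  desc_ι hk hc hkn _ _ v x

/-- **The size function is smooth.** [folklore] -/
theorem contMDiff_rho : ContMDiff (𝓡 (n + 1)) 𝓘(ℝ, ℝ) ∞ (rho hk hc hkn) :=
  contMDiff_desc hk hc hkn _ fun v => contMDiff_rhoTb hc v

/-- `continuous_rho` (continuous rho). [folklore] -/
theorem continuous_rho : Continuous (rho hk hc hkn) := (contMDiff_rho hk hc hkn).continuous

/-! ### §3 The fibre circle through a point of `Sᵏ × Sᵏ` -/

section Circle

variable (pq : (𝕊 k) × (𝕊 k))

/-- The first point `p`. [folklore] -/
abbrev cP : 𝔼 (k + 1) := (pq.1 : 𝔼 (k + 1))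
/-- The second point `q`. [folklore] -/
abbrev cQ : 𝔼 (k + 1) := (pq.2 : 𝔼 (k + 1))

/-- `norm_cP` (norm cP). [folklore] -/
theorem norm_cP : ‖cP pq‖ = 1 := norm_eq_of_mem_sphere pq.1
/-- `norm_cQ` (norm cQ). [folklore] -/
theorem norm_cQ : ‖cQ pq‖ = 1 := norm_eq_of_mem_sphere pq.2

/-- The tangent direction `w = p - ⟪p, q⟫ q` at `q` pointing towards `p`. [folklore] -/
def cW : 𝔼 (k + 1) := cP pq - (fibHt pq) • cQ pq

/-- `inner_cQ_cW` (inner cQ cW). [folklore] -/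
theorem inner_cQ_cW : ⟪cQ pq, cW pq⟫ = 0 := by
  simp only [cW, inner_sub_right, inner_smul_right, fibHt_apply, real_inner_self_eq_norm_sq, norm_cQ,
    one_pow, mul_one, real_inner_comm]
  ring

/-- `inner_cP_cW` (inner cP cW). [folklore] -/
theorem inner_cP_cW : ⟪cP pq, cW pq⟫ = 1 - fibHt pq ^ 2 := by
  simp only [cW, inner_sub_right, inner_smul_right, fibHt_apply, real_inner_self_eq_norm_sq, norm_cP,
    one_pow]
  ring

/-- `‖w‖² = 1 - ⟪p, q⟫² = b`. [folklore] -/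
theorem norm_cW_sq : ‖cW pq‖ ^ 2 = bFn pq := by
  rw [← real_inner_self_eq_norm_sq, cW, bFn]
  simp only [inner_sub_left, inner_sub_right, inner_smul_left, inner_smul_right,
    real_inner_self_eq_norm_sq, norm_cP, norm_cQ, RCLike.conj_to_real, real_inner_comm (cP pq) (cQ pq)]
  simp only [fibHt_apply]
  ring

/-- `norm_cW_pos` (norm cW pos). [folklore] -/
theorem norm_cW_pos (h : 0 < bFn pq) : 0 < ‖cW pq‖ := by
  have h2 : 0 < ‖cW pq‖ ^ 2 := by rw [norm_cW_sq]; exact h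
  exact lt_of_le_of_ne (norm_nonneg _) fun h0 => by rw [← h0] at h2; simp at h2

/-- The unit vector `u = w / ‖w‖`. [folklore] -/
def cU : 𝔼 (k + 1) := (‖cW pq‖)⁻¹ • cW pq

/-- The great circle `q_t = cos t • q + sin t • u` through `q` towards `p`. [folklore] -/
def circVec (t : ℝ) : 𝔼 (k + 1) := Real.cos t • cQ pq + Real.sin t • cU pq

/-- `norm_circVec` (norm circVec). [folklore] -/
theorem norm_circVec (h : 0 < bFn pq) (t : ℝ) : ‖circVec pq t‖ = 1 := by
  have hu : ‖cU pq‖ = 1 := by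
    rw [cU, norm_smul, norm_inv, norm_norm, inv_mul_cancel₀ (norm_cW_pos pq h).ne']
  have hqu : ⟪cQ pq, cU pq⟫ = 0 := by rw [cU, inner_smul_right, inner_cQ_cW, mul_zero]
  have hqu' : ⟪cU pq, cQ pq⟫ = 0 := by rw [real_inner_comm]; exact hqu
  have h1 : ‖circVec pq t‖ ^ 2 = 1 := by
    rw [← real_inner_self_eq_norm_sq, circVec]
    simp only [inner_add_left, inner_add_right, inner_smul_left, inner_smul_right,
      real_inner_self_eq_norm_sq, norm_cQ, hu, hqu, hqu', RCLike.conj_to_real]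
    nlinarith [Real.cos_sq_add_sin_sq t]
  exact (pow_eq_one_iff_of_nonneg (norm_nonneg _) two_ne_zero).1 h1

/-- `⟪p, q_t⟫ = ⟪p, q⟫ cos t + ‖w‖ sin t`. [folklore] -/
theorem inner_cP_circVec (h : 0 < bFn pq) (t : ℝ) :
    ⟪cP pq, circVec pq t⟫ = fibHt pq * Real.cos t + ‖cW pq‖ * Real.sin t := by
  have hpu : ⟪cP pq, cU pq⟫ = ‖cW pq‖ := by
    rw [cU, inner_smul_right, inner_cP_cW, ← bFn_apply, ← norm_cW_sq, sq, ← mul_assoc,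
      inv_mul_cancel₀ (norm_cW_pos pq h).ne', one_mul]
  rw [circVec, inner_add_right, inner_smul_right, inner_smul_right, hpu]
  simp only [fibHt_apply]
  ring

/-- **The fibre circle** through `(p, q)`: the base point fixed, the fibre point moving on the
great circle towards `p`. [folklore] -/
def circ (h : 0 < bFn pq) (t : ℝ) : (𝕊 k) × (𝕊 k) :=
  (pq.1, ⟨circVec pq t, by simp [norm_circVec pq h t]⟩)

/-- `circ_zero` (circ zero). [folklore] -/
theorem circ_zero (h : 0 < bFn pq) : circ pq h 0 = pq := by
  refine Prod.ext rfl (Subtype.ext ?_)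
  simp [circ, circVec]

/-- The fibre circle is smooth. [folklore] -/
theorem contMDiff_circ (h : 0 < bFn pq) : ContMDiff 𝓘(ℝ, ℝ) ((𝓡 k).prod (𝓡 k)) ∞ (circ pq h) := by
  refine contMDiff_const.prodMk ?_
  have hc : ContMDiff 𝓘(ℝ, ℝ) 𝓘(ℝ, 𝔼 (k + 1)) ∞ (circVec pq) := by
    apply ContDiff.contMDiff
    unfold circVec
    exact (Real.contDiff_cos.smul contDiff_const).add (Real.contDiff_sin.smul contDiff_const)
  exact hc.codRestrict_sphere _

/-- `continuous_circ` (continuous circ). [folklore] -/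
theorem continuous_circ (h : 0 < bFn pq) : Continuous (circ pq h) := (contMDiff_circ pq h).continuous

/-- Along the fibre circle the base height is constant. [folklore] -/
theorem baseHt_circ (h : 0 < bFn pq) (e : 𝕊 k) (t : ℝ) : baseHt e (circ pq h t) = baseHt e pq := rfl

/-- Along the fibre circle the fibre height is `⟪p, q⟫ cos t + ‖w‖ sin t`. [folklore] -/
theorem fibHt_circ (h : 0 < bFn pq) (t : ℝ) :
    fibHt (circ pq h t) = fibHt pq * Real.cos t + ‖cW pq‖ * Real.sin t :=
  inner_cP_circVec pq h t

/-- `aFn_circ` (aFn circ). [folklore] -/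
theorem aFn_circ (h : 0 < bFn pq) (e : 𝕊 k) (t : ℝ) : aFn e (circ pq h t) = aFn e pq := rfl

/-- **The squared fibre radius decreases at unit... **: `d/dt b(circ t)|₀ = -2 ⟪p, q⟫ ‖w‖`.
[folklore] -/
theorem hasDerivAt_bFn_circ (h : 0 < bFn pq) :
    HasDerivAt (fun t => bFn (circ pq h t)) (-(2 * fibHt pq * ‖cW pq‖)) 0 := by
  have heq : (fun t => bFn (circ pq h t)) =
      fun t => 1 - (fibHt pq * Real.cos t + ‖cW pq‖ * Real.sin t) *
        (fibHt pq * Real.cos t + ‖cW pq‖ * Real.sin t) := by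
    funext t; rw [bFn, fibHt_circ, sq]
  rw [heq]
  have h1 : HasDerivAt (fun t => fibHt pq * Real.cos t + ‖cW pq‖ * Real.sin t)
      (fibHt pq * (-Real.sin 0) + ‖cW pq‖ * Real.cos 0) 0 :=
    ((Real.hasDerivAt_cos 0).const_mul _).add ((Real.hasDerivAt_sin 0).const_mul _)
  have h2 := (h1.mul h1).const_sub 1
  refine h2.congr_deriv ?_
  simp only [Real.sin_zero, Real.cos_zero, mul_zero, neg_zero, zero_add, mul_one, add_zero]
  ring

end Circle

/-! ### §4 Regularity of the positive levels -/

section Regular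

variable {EM HM : Type*} [NormedAddCommGroup EM] [NormedSpace ℝ EM] [TopologicalSpace HM]
  {IM : ModelWithCorners ℝ EM HM} {M : Type*} [TopologicalSpace M] [ChartedSpace HM M]

/-- **A function with a nonzero derivative along some curve through `x` is not critical at `x`**
(chain rule: at a critical point every curve derivative vanishes). [cite: Milnor1963, §2] -/
theorem not_isMCriticalPt_of_hasDerivAt {f : M → ℝ} {Γ : ℝ → M}
    (hΓ : MDifferentiableAt 𝓘(ℝ, ℝ) IM Γ 0) (hf : MDifferentiableAt IM 𝓘(ℝ, ℝ) f (Γ 0))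
    {d : ℝ} (hd : HasDerivAt (f ∘ Γ) d 0) (hd0 : d ≠ 0) : ¬ IsMCriticalPt IM f (Γ 0) := by
  intro hcrit
  have hcomp := hf.hasMFDerivAt.comp 0 hΓ.hasMFDerivAt
  rw [show mfderiv IM 𝓘(ℝ, ℝ) f (Γ 0) = 0 from hcrit, ContinuousLinearMap.zero_comp] at hcomp
  have h0 : HasFDerivAt (f ∘ Γ) (0 : ℝ →L[ℝ] ℝ) 0 := hasMFDerivAt_iff_hasFDerivAt.1 hcomp
  have := hd.unique h0.hasDerivAt
  exact hd0 (by simpa using this)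

end Regular

/-- `IsParam.pos` (IsParam.pos). [folklore] -/
theorem IsParam.pos (hc : IsParam c) : 0 < c := by
  have h := hc.half_le
  have h0 := hc.nonneg
  nlinarith

/-- **Regularity along the fibre circle.** Let `x` be a point of the `v`-th tube with `b(x) > 0`
and suppose that on an open set `U ∋ x` the size function is a function of the squared fibre
radius, `ρ̂ᵥ = F ∘ b`, with `F'(b(x)) ≠ 0`. Then `ρ` is not critical at `ι v x`: along the fibre
circle `b` has derivative `-2⟪p, q⟫‖w‖ ≠ 0`. [cite: Milnor1963, §2] -/
theorem not_isMCriticalPt_rho_of_fibre (v : Fin 8) (x : Tb k c) {U : Set ((𝕊 k) × (𝕊 k))}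
    (hU : IsOpen U) (hxU : (x : (𝕊 k) × (𝕊 k)) ∈ U) {F : ℝ → ℝ} {F' : ℝ}
    (hF : HasDerivAt F F' (bFn (x : (𝕊 k) × (𝕊 k)))) (hF' : F' ≠ 0) (hb : 0 < bFn (x : (𝕊 k) × (𝕊 k)))
    (hUF : ∀ t, circ (x : (𝕊 k) × (𝕊 k)) hb t ∈ U →
      rhoHat k c v (circ (x : (𝕊 k) × (𝕊 k)) hb t) = F (bFn (circ (x : (𝕊 k) × (𝕊 k)) hb t))) :
    ¬ IsMCriticalPt (𝓡 (n + 1)) (rho hk hc hkn) (ι hk hc hkn v x) := by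
  set x₀ : (𝕊 k) × (𝕊 k) := (x : (𝕊 k) × (𝕊 k)) with hx₀
  -- a parameter interval on which the fibre circle stays in `U ∩ N`
  have hpre : (circ x₀ hb) ⁻¹' (U ∩ {y | c < fibHt y}) ∈ 𝓝 (0 : ℝ) := by
    apply (continuous_circ x₀ hb).continuousAt.preimage_mem_nhds
    rw [circ_zero]
    exact (hU.inter (isOpen_lt continuous_const continuous_fibHt)).mem_nhds ⟨hxU, x.2⟩
  obtain ⟨δ₀, hδ₀, hball⟩ := Metric.mem_nhds_iff.1 hpre
  set δ := δ₀ / 2 with hδ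
  have hδp : 0 < δ := by positivity
  have hmem : ∀ τ : ℝ, δ * Real.sin τ ∈ Metric.ball (0 : ℝ) δ₀ := by
    intro τ
    rw [Metric.mem_ball, dist_zero_right, Real.norm_eq_abs, abs_mul, abs_of_pos hδp]
    have := Real.abs_sin_le_one τ
    nlinarith
  have hin : ∀ τ : ℝ, circ x₀ hb (δ * Real.sin τ) ∈ U ∩ {y | c < fibHt y} := fun τ => hball (hmem τ)
  -- the curve in `PV`
  set γN : ℝ → Tb k c := fun τ => ⟨circ x₀ hb (δ * Real.sin τ), (hin τ).2⟩ with hγN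
  have hγN_smooth : ContMDiff 𝓘(ℝ, ℝ) ((𝓡 k).prod (𝓡 k)) ∞ γN := by
    rw [← ContMDiff.subtypeVal_comp_iff]
    exact (contMDiff_circ x₀ hb).comp ((contDiff_const.mul Real.contDiff_sin).contMDiff)
  set Γ : ℝ → PV k c hk hc hkn := fun τ => ι hk hc hkn v (γN τ) with hΓ
  have hΓ0 : Γ 0 = ι hk hc hkn v x := by
    simp only [hΓ, hγN, Real.sin_zero, mul_zero]
    congr 1
    exact Subtype.ext (circ_zero x₀ hb)
  have hΓ_smooth : ContMDiff 𝓘(ℝ, ℝ) (𝓡 (n + 1)) ∞ Γ := (contMDiff_ι hk hc hkn v).comp hγN_smooth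
  -- the composite `ρ ∘ Γ = F ∘ b ∘ circ ∘ (δ sin)`
  have hcomp : rho hk hc hkn ∘ Γ = fun τ => F (bFn (circ x₀ hb (δ * Real.sin τ))) := by
    funext τ
    simp only [comp_apply, hΓ, rho_ι]
    exact hUF _ (hin τ).1
  have hsin : HasDerivAt (fun τ : ℝ => δ * Real.sin τ) δ 0 := by
    simpa using (Real.hasDerivAt_sin 0).const_mul δ
  have hB : HasDerivAt ((fun t => bFn (circ x₀ hb t)) ∘ (fun τ : ℝ => δ * Real.sin τ))
      (-(2 * fibHt x₀ * ‖cW x₀‖) * δ) 0 := by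
    have h := hasDerivAt_bFn_circ x₀ hb
    have h' : HasDerivAt (fun t => bFn (circ x₀ hb t)) (-(2 * fibHt x₀ * ‖cW x₀‖)) (δ * Real.sin 0) := by
      simpa using h
    exact HasDerivAt.comp (0 : ℝ) h' hsin
  have hFB : HasDerivAt (F ∘ ((fun t => bFn (circ x₀ hb t)) ∘ (fun τ : ℝ => δ * Real.sin τ)))
      (F' * (-(2 * fibHt x₀ * ‖cW x₀‖) * δ)) 0 := by
    have hF0 : HasDerivAt F F' (((fun t => bFn (circ x₀ hb t)) ∘ (fun τ : ℝ => δ * Real.sin τ)) 0) := by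
      simpa [circ_zero] using hF
    exact HasDerivAt.comp (0 : ℝ) hF0 hB
  have hd0 : F' * (-(2 * fibHt x₀ * ‖cW x₀‖) * δ) ≠ 0 := by
    have h1 : 0 < fibHt x₀ := lt_trans hc.pos x.2
    have h2 : 0 < ‖cW x₀‖ := norm_cW_pos x₀ hb
    have : 0 < 2 * fibHt x₀ * ‖cW x₀‖ * δ := by positivity
    intro h0
    rcases mul_eq_zero.1 h0 with h0 | h0
    · exact hF' h0
    · nlinarith
  rw [← hΓ0]
  refine not_isMCriticalPt_of_hasDerivAt (hΓ_smooth.mdifferentiableAt (by simp))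
    ((contMDiff_rho hk hc hkn).mdifferentiableAt (by simp)) ?_ hd0
  rw [hcomp]; exact hFB

/-- The plumbing map identifies `x ∈ D_{e(v,w)}` in the `v`-th tube with `pm x` in the `w`-th tube.
[cite: Kosinski1993, VI.12 pp. 120–122] -/
theorem ι_pm (v w : Fin 8) (hvw : kosinskiGamma8 v w = 1) {x : Tb k c} (hx : (x : (𝕊 k) × (𝕊 k)) ∈ dom k c (ecol v w)) :
    ι hk hc hkn w (pm hc (ecol v w) x) = ι hk hc hkn v x :=
  ((ι_eq_ι_iff hk hc hkn).2 (Or.inr ⟨hvw, hx, rfl⟩)).symm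

/-- Regularity at a point of a plumbing domain whose fibre slope `G_b` does not vanish: the fibre
circle of `x` in the `v`-th tube. [cite: Milnor1963, §2] -/
theorem not_isMCriticalPt_rho_of_slopeB {v w : Fin 8} (hvw : kosinskiGamma8 v w = 1) {x : Tb k c}
    (hx : (x : (𝕊 k) × (𝕊 k)) ∈ dom k c (ecol v w))
    (hsB : slopeB (rsq c) bandSlope (aFn (pole k (ecol v w).val) (x : (𝕊 k) × (𝕊 k)),
      bFn (x : (𝕊 k) × (𝕊 k))) ≠ 0) (hb0 : 0 < bFn (x : (𝕊 k) × (𝕊 k))) :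
    ¬ IsMCriticalPt (𝓡 (n + 1)) (rho hk hc hkn) (ι hk hc hkn v x) := by
  have hlt := aFn_add_bFn_lt hc hx
  refine not_isMCriticalPt_rho_of_fibre hk hc hkn v x (isOpen_dom c (ecol v w)) hx
    (F := fun t => cornerFn (rsq c) bandSlope (aFn (pole k (ecol v w).val) (x : (𝕊 k) × (𝕊 k)), t))
    (hasDerivAt_cornerFn_snd bandSlope_pos hlt) hsB hb0 (fun t ht => ?_)
  rw [rhoHat_eq_cornerFn hk hc hvw ht, aFn_circ]

/-- **Every positive level of the size function is regular.** At a level point `ι v x` of the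
`v`-th tube: off the plumbing domains `ρ̂ᵥ = b` near `x` and the fibre circle has `ḃ ≠ 0`; on the
plumbing domain of the edge `{v, w}`, `ρ̂ᵥ = G(a, b)` with `G_a + G_b ≥ 1`, so either
`G_b ≠ 0` and the fibre circle of `x` works, or `G_a ≥ 1` and — reading the same point as
`ι w (pm x)`, where the roles of `a` and `b` are exchanged — the fibre circle of `pm x` in the
`w`-th tube works. [cite: Kosinski1993, VI.12 pp. 120–122] [cite: Milnor1963, §2–§3] -/
theorem not_isMCriticalPt_rho {ε : ℝ} (hε : 0 < ε) {p : PV k c hk hc hkn} (hp : rho hk hc hkn p = ε) :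
    ¬ IsMCriticalPt (𝓡 (n + 1)) (rho hk hc hkn) p := by
  obtain ⟨v, x, rfl⟩ := exists_ι_eq hk hc hkn p
  rw [rho_ι] at hp
  by_cases hzone : ∃ w, kosinskiGamma8 v w = 1 ∧ (x : (𝕊 k) × (𝕊 k)) ∈ dom k c (ecol v w)
  · obtain ⟨w, hvw, hx⟩ := hzone
    set a := aFn (pole k (ecol v w).val) (x : (𝕊 k) × (𝕊 k)) with ha
    set b := bFn (x : (𝕊 k) × (𝕊 k)) with hb
    have hG : cornerFn (rsq c) bandSlope (a, b) = ε := by rw [← rhoHat_eq_cornerFn hk hc hvw hx, hp]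
    have hlt : a + b < 2 * rsq c := aFn_add_bFn_lt hc hx
    obtain ⟨ha0, hb0⟩ := pos_of_cornerFn_pos bandSlope_pos (p := (a, b)) hlt (by rw [hG]; exact hε)
    by_cases hsB : slopeB (rsq c) bandSlope (a, b) ≠ 0
    · exact not_isMCriticalPt_rho_of_slopeB hk hc hkn hvw hx hsB hb0
    · -- `G_b = 0`, so `G_a ≥ 1`: read the point in the `w`-th tube
      have hsB0 : slopeB (rsq c) bandSlope (a, b) = 0 := not_not.1 hsB
      have hsA : slopeA (rsq c) bandSlope (a, b) ≠ 0 := by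
        have := one_le_slopeA_add_slopeB (r2 := rsq c) bandSlope_pos (a, b)
        rw [hsB0, add_zero] at this
        linarith
      have hwv : kosinskiGamma8 w v = 1 := by rw [gamma8_comm]; exact hvw
      set x' : Tb k c := pm hc (ecol v w) x with hx'
      have hcoe : (x' : (𝕊 k) × (𝕊 k)) = plumbMap (pole k (ecol v w).val) (x : (𝕊 k) × (𝕊 k)) :=
        coe_pm_of_mem hc hx
      have hx'dom : (x' : (𝕊 k) × (𝕊 k)) ∈ dom k c (ecol w v) := by
        rw [ecol_comm]; exact pm_mem_dom hc hx
      have hbase : -1 < baseHt (pole k (ecol v w).val) (x : (𝕊 k) × (𝕊 k)) :=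
        lt_of_le_of_lt hc.neg_one_le hx.1
      have hfib : -1 < fibHt (x : (𝕊 k) × (𝕊 k)) := lt_of_le_of_lt hc.neg_one_le hx.2
      have ha' : aFn (pole k (ecol w v).val) (x' : (𝕊 k) × (𝕊 k)) = b := by
        rw [ecol_comm, hcoe, aFn_plumbMap _ hbase]
      have hb' : bFn (x' : (𝕊 k) × (𝕊 k)) = a := by
        rw [hcoe, bFn_plumbMap _ hbase hfib]
      rw [← ι_pm hk hc hkn v w hvw hx]
      refine not_isMCriticalPt_rho_of_slopeB hk hc hkn hwv hx'dom ?_ ?_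
      · rw [ha', hb', ← slopeA_swap]
        exact hsA
      · rw [hb']; exact ha0
  · -- off all plumbing domains: `ρ̂ᵥ = b` near `x`
    push Not at hzone
    set U : Set ((𝕊 k) × (𝕊 k)) := ⋂ w ∈ Finset.univ.filter (fun w => kosinskiGamma8 v w = 1),
      vanishSet k c (ecol v w) with hU
    have hUo : IsOpen U := isOpen_biInter_finset fun w _ => isOpen_vanishSet _
    have hxU : (x : (𝕊 k) × (𝕊 k)) ∈ U := by
      simp only [hU, mem_iInter, Finset.mem_filter, Finset.mem_univ, true_and]
      exact fun w hw => mem_vanishSet_of_not_mem hc x.2 (hzone w hw)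
    have hUF : ∀ y ∈ U, rhoHat k c v y = bFn y := by
      intro y hy
      simp only [hU, mem_iInter, Finset.mem_filter, Finset.mem_univ, true_and] at hy
      rw [rhoHat, add_eq_left]
      exact Finset.sum_eq_zero fun w hw => termFn_eq_zero_of_mem_vanishSet hc (hy w (by simpa using hw))
    have hb0 : 0 < bFn (x : (𝕊 k) × (𝕊 k)) := by rw [← hUF _ hxU, hp]; exact hε
    exact not_isMCriticalPt_rho_of_fibre hk hc hkn v x hUo hxU (F := id) (hasDerivAt_id _) one_ne_zero hb0
      (fun t ht => by rw [hUF _ ht]; rfl)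

/-- **Every positive value is a regular level of `ρ`** (in the tree's sense
`Literature.Topology.FourManifolds.IsRegularLevel`). [cite: Milnor1963, Thm. 3.1] -/
theorem isRegularLevel_rho {ε : ℝ} (hε : 0 < ε) : IsRegularLevel (𝓡 (n + 1)) (rho hk hc hkn) ε :=
  isRegularLevel_of_not_isMCriticalPt (contMDiff_rho hk hc hkn) fun _ hp => not_isMCriticalPt_rho hk hc hkn hε hp

/-! ### §5 Compactness of the small sublevel sets and the compact plumbing `M(4m)` -/

/-- The bound below which the sublevel sets `{ρ ≤ ε}` are compact: `ε₀ = r²/8`. [folklore] -/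
def epsMax (c : ℝ) : ℝ := rsq c / 8

/-- `epsMax_pos` (epsMax pos). [folklore] -/
theorem epsMax_pos (hc : IsParam c) : 0 < epsMax c := by
  have := rsq_pos hc; rw [epsMax]; positivity

variable (k c) in
/-- The compact piece `K_v(ε) = {⟪p, q⟫ ≥ 0, b ≤ r²/2, ρ̂ᵥ ≤ ε}` of `Sᵏ × Sᵏ` (inside the tube).
[folklore] -/
def Kset (v : Fin 8) (ε : ℝ) : Set ((𝕊 k) × (𝕊 k)) :=
  {y | 0 ≤ fibHt y ∧ bFn y ≤ rsq c / 2 ∧ rhoHat k c v y ≤ ε}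

/-- Points with `⟪p, q⟫ ≥ 0` and `b ≤ r²/2` lie in the tube `{⟪p, q⟫ > c}`. [folklore] -/
theorem lt_fibHt_of_bFn_le (hc : IsParam c) {y : (𝕊 k) × (𝕊 k)} (h0 : 0 ≤ fibHt y)
    (hb : bFn y ≤ rsq c / 2) : c < fibHt y := by
  have hR := rsq_pos hc
  have hc0 := hc.nonneg
  rw [bFn, rsq] at hb
  rw [rsq] at hR
  nlinarith

/-- `K_v(ε)` is closed (hence compact): `ρ̂ᵥ` is continuous on the closed set
`{⟪p, q⟫ ≥ 0, b ≤ r²/2}`, which lies in the tube. [folklore] -/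
theorem isClosed_Kset (hc : IsParam c) (v : Fin 8) (ε : ℝ) : IsClosed (Kset k c v ε) := by
  have hC : IsClosed {y : (𝕊 k) × (𝕊 k) | 0 ≤ fibHt y ∧ bFn y ≤ rsq c / 2} :=
    (isClosed_le continuous_const continuous_fibHt).inter (isClosed_le continuous_bFn continuous_const)
  have hcont : ContinuousOn (rhoHat k c v) {y : (𝕊 k) × (𝕊 k) | 0 ≤ fibHt y ∧ bFn y ≤ rsq c / 2} :=
    fun y hy => (contMDiffAt_rhoHat hc v (lt_fibHt_of_bFn_le hc hy.1 hy.2)).continuousAt.continuousWithinAt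
  have h := hcont.preimage_isClosed_of_isClosed hC isClosed_Iic (t := Iic ε)
  convert h using 1
  ext y; simp [Kset, and_assoc]

/-- `isCompact_Kset` (isCompact Kset). [folklore] -/
theorem isCompact_Kset (hc : IsParam c) (v : Fin 8) (ε : ℝ) : IsCompact (Kset k c v ε) :=
  (isClosed_Kset hc v ε).isCompact

/-- `Kset_subset_Tb` (Kset subset Tb). [folklore] -/
theorem Kset_subset_Tb (hc : IsParam c) (v : Fin 8) (ε : ℝ) : Kset k c v ε ⊆ (Tb k c : Set ((𝕊 k) × (𝕊 k))) :=
  fun _ hy => lt_fibHt_of_bFn_le hc hy.1 hy.2.1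

/-- `K_v(ε)` as a compact subset of the tube. [folklore] -/
theorem isCompact_preimage_Kset (hc : IsParam c) (v : Fin 8) (ε : ℝ) :
    IsCompact ((Subtype.val : Tb k c → (𝕊 k) × (𝕊 k)) ⁻¹' Kset k c v ε) := by
  rw [Topology.IsEmbedding.subtypeVal.isCompact_iff, image_preimage_eq_of_subset]
  · exact isCompact_Kset hc v ε
  · rw [Subtype.range_val]; exact Kset_subset_Tb hc v ε

/-- **The sublevel set `{ρ ≤ ε}` is covered by the eight compact pieces** (`0 < ε ≤ ε₀`): a point
`ι v x` with `ρ̂ᵥ x ≤ ε` either has `b(x) ≤ r²/2`, or lies in a plumbing domain with `a(x)` small,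
and then it is `ι w (pm x)` with `b(pm x) = a(x) ≤ r²/2`. [cite: Kosinski1993, VI.12 pp. 120–122] -/
theorem exists_mem_Kset_of_rho_le {ε : ℝ} (hε : ε ≤ epsMax c) {p : PV k c hk hc hkn}
    (hp : rho hk hc hkn p ≤ ε) :
    ∃ (v : Fin 8) (x : Tb k c), (x : (𝕊 k) × (𝕊 k)) ∈ Kset k c v ε ∧ ι hk hc hkn v x = p := by
  obtain ⟨v, x, rfl⟩ := exists_ι_eq hk hc hkn p
  rw [rho_ι] at hp
  have hR := rsq_pos hc
  have hfx : 0 ≤ fibHt (x : (𝕊 k) × (𝕊 k)) := (hc.nonneg.trans x.2.le)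
  by_cases hbx : bFn (x : (𝕊 k) × (𝕊 k)) ≤ rsq c / 2
  · exact ⟨v, x, ⟨hfx, hbx, hp⟩, rfl⟩
  · push Not at hbx
    -- `x` lies in some plumbing domain (else `ρ̂ᵥ x = b(x) > r²/2 > ε`)
    have hzone : ∃ w, kosinskiGamma8 v w = 1 ∧ (x : (𝕊 k) × (𝕊 k)) ∈ dom k c (ecol v w) := by
      by_contra hno
      push Not at hno
      rw [rhoHat_eq_bFn v hno] at hp
      rw [epsMax] at hε; linarith
    obtain ⟨w, hvw, hx⟩ := hzone
    rw [rhoHat_eq_cornerFn hk hc hvw hx] at hp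
    have hlt := aFn_add_bFn_lt hc hx
    have hlow := min_sub_le_cornerFn bandSlope_pos
      (p := (aFn (pole k (ecol v w).val) (x : (𝕊 k) × (𝕊 k)), bFn (x : (𝕊 k) × (𝕊 k)))) hlt
    simp only [bandW] at hlow
    have ha0 := aFn_nonneg (pole k (ecol v w).val) (x : (𝕊 k) × (𝕊 k))
    have hb0 := bFn_nonneg (x : (𝕊 k) × (𝕊 k))
    -- hence `a(x) ≤ r²/2`
    have ha : aFn (pole k (ecol v w).val) (x : (𝕊 k) × (𝕊 k)) ≤ rsq c / 2 := by
      rw [epsMax] at hε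
      rw [min_def] at hlow
      simp only [bandSlope] at hlow hp
      split_ifs at hlow with hab
      · nlinarith
      · nlinarith
    refine ⟨w, pm hc (ecol v w) x, ⟨?_, ?_, ?_⟩, ι_pm hk hc hkn v w hvw hx⟩
    · exact hc.nonneg.trans (pm hc (ecol v w) x).2.le
    · rw [coe_pm_of_mem hc hx, bFn_plumbMap _ (lt_of_le_of_lt hc.neg_one_le hx.1)
        (lt_of_le_of_lt hc.neg_one_le hx.2)]
      exact ha
    · rw [coe_pm_of_mem hc hx, rhoHat_plumbMap hk hc hvw hx, rhoHat_eq_cornerFn hk hc hvw hx]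
      exact hp

/-- **The sublevel sets `{ρ ≤ ε}`, `0 < ε ≤ ε₀`, are compact.** [cite: Kosinski1993, VI.12 pp. 120–122] -/
theorem isCompact_rho_le {ε : ℝ} (hε : ε ≤ epsMax c) : IsCompact (rho hk hc hkn ⁻¹' Iic ε) := by
  have hK : IsCompact (⋃ v : Fin 8, ι hk hc hkn v '' ((Subtype.val : Tb k c → (𝕊 k) × (𝕊 k)) ⁻¹' Kset k c v ε)) :=
    isCompact_iUnion fun v => (isCompact_preimage_Kset hc v ε).image (continuous_ι hk hc hkn v)
  refine hK.of_isClosed_subset (isClosed_Iic.preimage (continuous_rho hk hc hkn)) fun p hp => ?_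
  obtain ⟨v, x, hx, rfl⟩ := exists_mem_Kset_of_rho_le hk hc hkn hε hp
  exact mem_iUnion.2 ⟨v, x, hx, rfl⟩

/-- **The compact `E₈` plumbing `M(4m) = {ρ ≤ ε}`** (Kosinski 1993, VI.12; a compact `C^∞`
manifold with boundary `{ρ = ε}`, the regular sublevel set of the size function — Milnor 1963,
Thm. 3.1), for `0 < ε ≤ ε₀`. [cite: Kosinski1993, VI.12 pp. 119–122] [cite: Milnor1963, Thm. 3.1] -/
def Wc {ε : ℝ} (hε : 0 < ε) : Type := RegularSublevel (isRegularLevel_rho hk hc hkn hε)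

variable {ε : ℝ} (hε : 0 < ε)

/-- The subspace topology on `M(4m) = {ρ ≤ ε}` (from `RegularSublevel`). [folklore] -/
instance : TopologicalSpace (Wc hk hc hkn hε) := inferInstanceAs (TopologicalSpace (RegularSublevel _))
/-- `M(4m)` is Hausdorff (subspace of `PV`). [folklore] -/
instance : T2Space (Wc hk hc hkn hε) := inferInstanceAs (T2Space (RegularSublevel _))
/-- `M(4m)` is second countable (subspace of `PV`). [folklore] -/
instance : SecondCountableTopology (Wc hk hc hkn hε) := inferInstanceAs (SecondCountableTopology (RegularSublevel _))
/-- The half-space atlas of `M(4m)` (Milnor 1963, Thm. 3.1, via `RegularSublevel`). [cite: Milnor1963, Thm. 3.1] -/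
instance : ChartedSpace (EuclideanHalfSpace (n + 1)) (Wc hk hc hkn hε) :=
  inferInstanceAs (ChartedSpace (EuclideanHalfSpace (n + 1)) (RegularSublevel _))
/-- `M(4m)` is a `C^∞` manifold with boundary (Milnor 1963, Thm. 3.1, via `RegularSublevel`). [cite: Milnor1963, Thm. 3.1] -/
instance : IsManifold (𝓡∂ (n + 1)) ∞ (Wc hk hc hkn hε) := inferInstanceAs (IsManifold (𝓡∂ (n + 1)) ∞ (RegularSublevel _))

/-- **`M(4m)` is compact** (`ε ≤ ε₀`). [cite: Kosinski1993, VI.12 pp. 119–122] -/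
theorem compactSpace_Wc (hε' : ε ≤ epsMax c) : CompactSpace (Wc hk hc hkn hε) :=
  isCompact_iff_compactSpace.1 (isCompact_rho_le hk hc hkn hε')

/-- The inclusion `M(4m) → PV`. [folklore] -/
def Wc.incl : Wc hk hc hkn hε → PV k c hk hc hkn := RegularSublevel.incl _

/-- `Wc.rho_incl_le` (Wc.rho incl le). [folklore] -/
theorem Wc.rho_incl_le (p : Wc hk hc hkn hε) : rho hk hc hkn (Wc.incl hk hc hkn hε p) ≤ ε := p.2

/-- The boundary datum `∂M(4m) = {ρ = ε}`. [cite: Milnor1963, Thm. 3.1] -/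
def Wc.bd : BoundaryData (𝓡∂ (n + 1)) (Wc hk hc hkn hε) (𝓡 n) :=
  RegularSublevel.boundaryData (isRegularLevel_rho hk hc hkn hε)

/-- A point of a tube with `ρ̂ᵥ ≤ ε` gives a point of `M(4m)`. [folklore] -/
def Wc.mk (v : Fin 8) (x : Tb k c) (hx : rhoHat k c v x ≤ ε) : Wc hk hc hkn hε :=
  ⟨ι hk hc hkn v x, by change rho hk hc hkn (ι hk hc hkn v x) ≤ ε; rw [rho_ι]; exact hx⟩

include hc in
/-- On the diagonal (the cores) the size function is `≤ 0`. [folklore] -/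
theorem rhoHat_diagPt_le (v : Fin 8) (p : 𝕊 k) : rhoHat k c v (p, p) ≤ 0 := by
  have hb : bFn ((p, p) : (𝕊 k) × (𝕊 k)) = 0 := by
    rw [bFn, fibHt_apply]
    simp [norm_eq_of_mem_sphere p]
  have := rhoHat_le_bFn hc v ((p, p) : (𝕊 k) × (𝕊 k))
  linarith

/-- `M(4m)` is nonempty (it contains the cores). [folklore] -/
instance : Nonempty (Wc hk hc hkn hε) :=
  ⟨Wc.mk hk hc hkn hε 0 (diagPt hc.lt_one (pole k 0)) ((rhoHat_diagPt_le hc 0 _).trans hε.le)⟩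

/-- **`M(4m)` as a null-cobordism of its boundary** (Kervaire–Milnor's `W` with `bW = ∂M(4m)`),
`0 < ε ≤ ε₀`. [cite: Kosinski1993, VI.12 pp. 119–122] [cite: Milnor1963, Thm. 3.1] -/
def Wc.nullCobordism (hε' : ε ≤ epsMax c) : NullCobordism n (Wc.bd hk hc hkn hε).carrier :=
  letI := compactSpace_Wc hk hc hkn hε hε'
  { W := Wc hk hc hkn hε
    incl := (Wc.bd hk hc hkn hε).incl
    isSmoothEmbedding_incl := (Wc.bd hk hc hkn hε).isSmoothEmbedding
    range_incl := (Wc.bd hk hc hkn hε).range_incl }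

/-- The bounding manifold of the null-cobordism is `M(4m)` (definitional). [folklore] -/
@[simp] theorem Wc.nullCobordism_W (hε' : ε ≤ epsMax c) : (Wc.nullCobordism hk hc hkn hε hε').W = Wc hk hc hkn hε := rfl

end Plumbing

end Literature.Topology.FourManifolds
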